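import Mathlib.Geometry.Manifold.Instances.Sphere
import Mathlib.Geometry.Manifold.Instances.Real
import Mathlib.Geometry.Manifold.IsManifold.InteriorBoundary
import Mathlib.Geometry.Manifold.MFDeriv.Basic
import Mathlib.LinearAlgebra.Dimension.Finrank
import Mathlib.Order.Lattice.Nat
import Literature.Topology.FourManifolds.Knots
import Literature.Topology.FourManifolds.SliceRibbon
import Literature.Topology.FourManifolds.SmoothOrientation
import Literature.AlgebraicTopology.SingularHomology.SingularChains
import HarnessLib

-- provenance: harness21/H21/H21/Prelude/FourManL/SliceGenus.lean @ 3097bc8 (interim HEAD d8f2665); M5 mechanical rewrite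
/-!
# Slice genus and Seifert genus of a knot (trunk T-4MAN / FourManL, outline C11)

This prelude file of the H21 library (trunk `FourManL`; notions
`khovanov_homology_rasmussen_s`, `slice_ribbon_concordance`) defines, for classical knots
`K : 𝕊 1 → 𝕊 3` (`Literature.Topology.FourManifolds.Knot`), the two genera deferred by the `FourManM` file `SliceRibbon`
(§4.8 of its outline) and needed by `spc4.S28` (Rasmussen's bound `|s(K)| ≤ 2 g₄(K)`):

* `Literature.Knot.IsSpanningSurfaceOfGenus K F e g`: the common core of the two notions — a compact
  connected orientable smooth surface `S` with one boundary circle (identified with `𝕊 1` by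
  `e`), a smooth injective immersion `F : S → ℝ⁴` restricting to `K ∘ e` on `∂S`, and
  `rank H₁(S; ℤ) = 2g`;
* `Literature.Knot.HasSliceSurfaceOfGenus K g`: `K` bounds such a surface with interior in the open
  unit ball `B⁴` (a *slice surface* of genus `g`);
* `Literature.Knot.HasSeifertSurfaceOfGenus K g`: `K` bounds such a surface inside `𝕊 3` (a
  *Seifert surface* of genus `g`);
* `Literature.Knot.sliceGenus K = g₄(K)` and `Literature.Knot.genus K = g(K)`, the minima.

API (named facts `def … : Prop`, all classical): existence of Seifert surfaces (Seifert 1934), `g₄ ≤ g`,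
`g₄ = 0 ↔ smoothly slice` (bridge to `Literature.Topology.FourManifolds.Knot.IsSmoothlySlice`), concordance / isotopy /
mirror invariance of `g₄`, `g = 0 ↔ unknot` (Dehn's lemma, Papakyriakopoulos 1957), and
monotonicity of `HasSliceSurfaceOfGenus` in `g` (adding handles).

## Sources

* H. Seifert, *Über das Geschlecht von Knoten*, Math. Ann. 110 (1934) (Seifert surfaces,
  genus).
* R. H. Fox, *A quick trip through knot theory* (1962), §7; K. Murasugi, *On a certain
  numerical invariant of link types*, Trans. AMS 117 (1965) (slice / 4-ball genus).
* C. D. Papakyriakopoulos, *On Dehn's lemma and the asphericity of knots*, Ann. of Math. 66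
  (1957) (genus `0` iff unknot).
* C. Livingston, *A survey of classical knot concordance*, Handbook of knot theory (2005),
  §2–3 (`g₄` is a concordance invariant, `g₄ ≤ g`).
* J. Rasmussen, *Khovanov homology and the slice genus*, Invent. Math. 182 (2010), §1.
* Mathlib: `ModelWithCorners.boundary`, `ModelWithCorners.interior`, `EuclideanHalfSpace`,
  `mfderiv`, `Module.finrank`; H21: `Literature.AlgebraicTopology.SingularHomology.singularHomology`, `Literature.Topology.FourManifolds.IsOrientable`,
  `Literature.Topology.FourManifolds.Knot.IsSmoothlySlice`, `Literature.Topology.FourManifolds.Knot.IsConcordant`. Mathlib (v4.32.0) has no Seifert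
  surfaces, knot genus or slice genus (searched `Seifert`, `sliceGenus`, `genus`).

## Design choices

* Surfaces are abstract compact smooth 2-manifolds with boundary, modelled on
  `EuclideanHalfSpace 2` with corners model `𝓡∂ 2`, mapped into `ℝ⁴ ⊃ 𝕊 3 = ∂B⁴` by a smooth
  injective immersion (= smooth embedding, `S` being compact).  The genus is read off from
  `H₁(S; ℤ) ≅ ℤ^{2g}` (valid for a compact connected orientable surface with exactly one
  boundary circle), using the accepted `Literature.singularHomology ℤ ℤ S 1`.
* The boundary `∂S` is identified with `𝕊 1` by a homeomorphism `e`, and we ask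
  `F x = K (e x)` on `∂S`.  We do **not** ask `e` to be a diffeomorphism nor to respect the
  orientation of `K`'s parametrisation: both are irrelevant for the genus (reverse the
  orientation of `S`).
* Neatness / transversality of a slice surface along `∂B⁴` is omitted: it is irrelevant for
  the genus, since any such surface is isotopic rel boundary to a neat one (straighten a
  collar).  The bridge to the neat-disc definition `Literature.Topology.FourManifolds.Knot.IsSmoothlySlice` of
  `SliceRibbon` is the named fact `Literature.Topology.FourManifolds.Knot.sliceGenus_eq_zero_iff`.
* `sliceGenus` and `genus` are `sInf`s over `ℕ`; the junk value `Nat.sInf ∅ = 0` never occurs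
  given the named fact `exists_hasSeifertSurfaceOfGenus` / `exists_hasSliceSurfaceOfGenus`.
* The surface type `S` is quantified in `Type` (universe `0`), which is where `𝕊 1`, `𝕊 3`
  and all concrete surfaces live.
* Notation `𝔼 n`, `𝕊 n` is local, exactly as in the `FourManM` files.
-/

open scoped Manifold ContDiff Topology
open Function Set

noncomputable section

namespace Literature.Topology.FourManifolds

/-- Local notation: `𝔼 n` is the model Euclidean space `EuclideanSpace ℝ (Fin n)`. -/
local notation "𝔼 " n:arg => EuclideanSpace ℝ (Fin n)

/-- Local notation: `𝕊 n` is the unit sphere in `EuclideanSpace ℝ (Fin (n + 1))`. -/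
local notation "𝕊 " n:arg => (Metric.sphere (0 : EuclideanSpace ℝ (Fin (n + 1))) 1)

namespace Knot

/-! ## Spanning surfaces -/

/-- The common core of slice and Seifert surfaces of genus `g` for a knot `K`: `S` is a
compact connected smooth surface with boundary, `e : ∂S ≃ₜ 𝕊 1` identifies its boundary with
one circle, `F : S → ℝ⁴` is a smooth injective immersion (hence, `S` being compact, a smooth
embedding) with `F = K ∘ e` on `∂S`, `S` is orientable, and `rank_ℤ H₁(S; ℤ) = 2g` (so `S`
is a once-punctured closed orientable surface of genus `g`).  Compactness and connectedness
of `S` are not used in this predicate; they are imposed in `HasSliceSurfaceOfGenus` and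
`HasSeifertSurfaceOfGenus`.
Seifert (1934); Livingston (2005), §2. [cite: Seifert1934] -/
def IsSpanningSurfaceOfGenus (K : Knot) {S : Type} [TopologicalSpace S]
    [ChartedSpace (EuclideanHalfSpace 2) S] [IsManifold (𝓡∂ 2) ∞ S]
    (F : S → 𝔼 4) (e : ↥((𝓡∂ 2).boundary S) ≃ₜ ↥(𝕊 1)) (g : ℕ) : Prop :=
  IsOrientable (𝓡∂ 2) S ∧ ContMDiff (𝓡∂ 2) 𝓘(ℝ, 𝔼 4) ∞ F ∧ Injective F ∧
    (∀ x, Injective (mfderiv (𝓡∂ 2) 𝓘(ℝ, 𝔼 4) F x)) ∧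
    (∀ x : ↥((𝓡∂ 2).boundary S), F x = ((K (e x) : 𝕊 3) : 𝔼 4)) ∧
    Module.finrank ℤ (Literature.AlgebraicTopology.SingularHomology.singularHomology ℤ ℤ S 1) = 2 * g

/-- `K` **bounds a slice surface of genus `g`**: there is a compact connected orientable
smooth surface `S` of genus `g` with one boundary circle and a smooth embedding
`F : S ↪ B⁴ ⊂ ℝ⁴` with `F|∂S = K` (up to reparametrisation of the circle) and
`F(int S) ⊂ int B⁴`.  Neatness along `∂B⁴ = 𝕊 3` is not required (irrelevant for the genus:
any such surface is isotopic rel `∂` to a neat one).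
Fox (1962), §7; Murasugi (1965); Livingston (2005), §2. [cite: Fox1962] -/
def HasSliceSurfaceOfGenus (K : Knot) (g : ℕ) : Prop :=
  ∃ (S : Type) (_ : TopologicalSpace S) (_ : T2Space S) (_ : SecondCountableTopology S)
    (_ : CompactSpace S) (_ : ConnectedSpace S) (_ : ChartedSpace (EuclideanHalfSpace 2) S)
    (_ : IsManifold (𝓡∂ 2) ∞ S) (F : S → 𝔼 4) (e : ↥((𝓡∂ 2).boundary S) ≃ₜ ↥(𝕊 1)),
    K.IsSpanningSurfaceOfGenus F e g ∧ ∀ x ∈ (𝓡∂ 2).interior S, ‖F x‖ < 1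

/-- `K` **bounds a Seifert surface of genus `g`**: there is a compact connected orientable
smooth surface `S` of genus `g` with one boundary circle and a smooth embedding
`F : S ↪ 𝕊 3 ⊂ ℝ⁴` with `F|∂S = K` (up to reparametrisation of the circle).
Seifert (1934); Rolfsen, *Knots and Links* (1976), §5.A. [cite: Seifert1934] -/
def HasSeifertSurfaceOfGenus (K : Knot) (g : ℕ) : Prop :=
  ∃ (S : Type) (_ : TopologicalSpace S) (_ : T2Space S) (_ : SecondCountableTopology S)
    (_ : CompactSpace S) (_ : ConnectedSpace S) (_ : ChartedSpace (EuclideanHalfSpace 2) S)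
    (_ : IsManifold (𝓡∂ 2) ∞ S) (F : S → 𝔼 4) (e : ↥((𝓡∂ 2).boundary S) ≃ₜ ↥(𝕊 1)),
    K.IsSpanningSurfaceOfGenus F e g ∧ ∀ x, ‖F x‖ = 1

/-- The **slice genus** (4-ball genus) `g₄(K)`: the least genus of a slice surface for `K`
in `B⁴`.  Defined as `sInf`; the set is nonempty by `exists_hasSliceSurfaceOfGenus`, so the
junk value `Nat.sInf ∅ = 0` does not occur.
Fox (1962), §7; Murasugi (1965); Livingston (2005), §2; Rasmussen (2010), §1. [cite: Fox1962] -/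
def sliceGenus (K : Knot) : ℕ :=
  sInf {g | K.HasSliceSurfaceOfGenus g}

/-- The (Seifert) **genus** `g(K)` of a knot: the least genus of a Seifert surface for `K`
in `𝕊 3`.  Defined as `sInf`; the set is nonempty by `exists_hasSeifertSurfaceOfGenus`
(Seifert's algorithm), so the junk value `Nat.sInf ∅ = 0` does not occur.
Seifert (1934); Rolfsen (1976), §5.A. [cite: Seifert1934] -/
def genus (K : Knot) : ℕ :=
  sInf {g | K.HasSeifertSurfaceOfGenus g}

/-! ## API (classical theorems, as named facts) -/

/-- Every knot bounds a Seifert surface (Seifert's algorithm).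
Seifert (1934), Satz 1; Rolfsen (1976), §5.A.4. [cite: Seifert1934] -/
def exists_hasSeifertSurfaceOfGenus : Prop :=
  ∀ K : Knot, ∃ g, K.HasSeifertSurfaceOfGenus g

/-- A Seifert surface of genus `g` gives a slice surface of genus `g`: push its interior
radially into the open ball `B⁴`. Livingston (2005), §2. [cite: Livingston2005] -/
def HasSeifertSurfaceOfGenus.hasSliceSurfaceOfGenus : Prop :=
  ∀ {K : Knot} {g : ℕ} (_h : K.HasSeifertSurfaceOfGenus g), K.HasSliceSurfaceOfGenus g

/-- Every knot bounds a slice surface of some genus. Seifert (1934) + pushing into `B⁴`.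
Relies on the named facts `exists_hasSeifertSurfaceOfGenus` and
`HasSeifertSurfaceOfGenus.hasSliceSurfaceOfGenus`. [cite: Seifert1934] -/
theorem exists_hasSliceSurfaceOfGenus (hS : exists_hasSeifertSurfaceOfGenus)
    (hP : HasSeifertSurfaceOfGenus.hasSliceSurfaceOfGenus) (K : Knot) :
    ∃ g, K.HasSliceSurfaceOfGenus g := by
  obtain ⟨g, hg⟩ := hS K
  exact ⟨g, hP hg⟩

/-- Slice surfaces of genus `g` give slice surfaces of every genus `g' ≥ g` (add `g' - g`
small handles in the interior of `B⁴`). Livingston (2005), §2. [cite: Livingston2005] -/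
def HasSliceSurfaceOfGenus.mono : Prop :=
  ∀ {K : Knot} {g g' : ℕ} (_h : g ≤ g') (_hK : K.HasSliceSurfaceOfGenus g),
    K.HasSliceSurfaceOfGenus g'

/-- The slice genus is attained (given the named facts `exists_hasSeifertSurfaceOfGenus` and
`HasSeifertSurfaceOfGenus.hasSliceSurfaceOfGenus`). [folklore] -/
theorem hasSliceSurfaceOfGenus_sliceGenus (hS : exists_hasSeifertSurfaceOfGenus)
    (hP : HasSeifertSurfaceOfGenus.hasSliceSurfaceOfGenus) (K : Knot) :
    K.HasSliceSurfaceOfGenus K.sliceGenus :=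
  Nat.sInf_mem (exists_hasSliceSurfaceOfGenus hS hP K)

/-- The Seifert genus is attained (given the named fact `exists_hasSeifertSurfaceOfGenus`). [folklore] -/
theorem hasSeifertSurfaceOfGenus_genus (hS : exists_hasSeifertSurfaceOfGenus) (K : Knot) :
    K.HasSeifertSurfaceOfGenus K.genus :=
  Nat.sInf_mem (hS K)

/-- `g₄(K) ≤ g` as soon as `K` bounds a slice surface of genus `g`. [folklore] -/
theorem sliceGenus_le_of_hasSliceSurfaceOfGenus {K : Knot} {g : ℕ}
    (h : K.HasSliceSurfaceOfGenus g) : K.sliceGenus ≤ g :=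
  Nat.sInf_le h

/-- `g(K) ≤ g` as soon as `K` bounds a Seifert surface of genus `g`. [folklore] -/
theorem genus_le_of_hasSeifertSurfaceOfGenus {K : Knot} {g : ℕ}
    (h : K.HasSeifertSurfaceOfGenus g) : K.genus ≤ g :=
  Nat.sInf_le h

/-- `K` bounds a slice surface of genus `g` iff `g₄(K) ≤ g`.
Relies on the named facts `exists_hasSeifertSurfaceOfGenus`,
`HasSeifertSurfaceOfGenus.hasSliceSurfaceOfGenus` and `HasSliceSurfaceOfGenus.mono`. [folklore] -/
theorem hasSliceSurfaceOfGenus_iff_sliceGenus_le (hS : exists_hasSeifertSurfaceOfGenus)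
    (hP : HasSeifertSurfaceOfGenus.hasSliceSurfaceOfGenus) (hm : HasSliceSurfaceOfGenus.mono)
    {K : Knot} {g : ℕ} :
    K.HasSliceSurfaceOfGenus g ↔ K.sliceGenus ≤ g :=
  ⟨sliceGenus_le_of_hasSliceSurfaceOfGenus,
    fun h ↦ hm h (hasSliceSurfaceOfGenus_sliceGenus hS hP K)⟩

/-- **`g₄(K) ≤ g(K)`**: a Seifert surface pushed into `B⁴` is a slice surface (given the named
facts `exists_hasSeifertSurfaceOfGenus` and `HasSeifertSurfaceOfGenus.hasSliceSurfaceOfGenus`).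
Livingston (2005), §2. [cite: Livingston2005] -/
theorem sliceGenus_le_genus (hS : exists_hasSeifertSurfaceOfGenus)
    (hP : HasSeifertSurfaceOfGenus.hasSliceSurfaceOfGenus) (K : Knot) :
    K.sliceGenus ≤ K.genus :=
  sliceGenus_le_of_hasSliceSurfaceOfGenus (hP (hasSeifertSurfaceOfGenus_genus hS K))

/-- **`g₄(K) = 0` iff `K` is smoothly slice** in the sense of `Literature.Topology.FourManifolds.Knot.IsSmoothlySlice`
(a neat smooth slice disc `𝔻² → B⁴`): a genus-`0` slice surface is a disc, which can be
isotoped rel boundary to a neat one and parametrised by `𝔻²`; conversely a neat slice disc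
restricted to `𝔻²` is a slice surface of genus `0`. Fox (1962), §7; Livingston (2005), §2. [cite: Fox1962] -/
def sliceGenus_eq_zero_iff : Prop :=
  ∀ K : Knot, K.sliceGenus = 0 ↔ K.IsSmoothlySlice

/-- **The slice genus is a concordance invariant**: glue a concordance annulus to a slice
surface. Livingston (2005), §2, Theorem 2.2. [cite: Livingston2005] -/
def IsConcordant.sliceGenus_eq : Prop :=
  ∀ {K K' : Knot} (_h : K.IsConcordant K'), K.sliceGenus = K'.sliceGenus

/-- The slice genus is an isotopy invariant (isotopic knots are concordant; given the named
facts `IsConcordant.of_isIsotopic` and `IsConcordant.sliceGenus_eq`). [folklore] -/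
theorem IsIsotopic.sliceGenus_eq (hI : IsConcordant.of_isIsotopic)
    (hc : IsConcordant.sliceGenus_eq) {K K' : Knot} (h : K.IsIsotopic K') :
    K.sliceGenus = K'.sliceGenus :=
  hc (hI h)

/-- **`g₄` of the mirror image**: reflecting `B⁴` in the last coordinate carries slice
surfaces of `K` to slice surfaces of `K.mirror`. Livingston (2005), §2. [cite: Livingston2005] -/
def sliceGenus_mirror : Prop :=
  ∀ [SphereEmbedding.SmoothnessFacts] (K : Knot), K.mirror.sliceGenus = K.sliceGenus

/-- The Seifert genus is an isotopy invariant (ambient isotopy carries Seifert surfaces to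
Seifert surfaces). Rolfsen (1976), §5.A. [cite: Rolfsen1976] -/
def IsIsotopic.genus_eq : Prop :=
  ∀ {K K' : Knot} (_h : K.IsIsotopic K'), K.genus = K'.genus

/-- **A knot has genus `0` iff it is the unknot** (it bounds an embedded disc in `𝕊 3` iff
it is isotopic to the standard circle). Dehn's lemma, Papakyriakopoulos (1957);
Rolfsen (1976), §4.B, §5.A. [cite: Papakyriakopoulos1957] -/
def genus_eq_zero_iff_isUnknot : Prop :=
  ∀ [SphereEmbedding.SmoothnessFacts] (K : Knot), K.genus = 0 ↔ K.IsUnknot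

/-- The unknot has slice genus `0` (it is smoothly slice).
Relies on the named fact `sliceGenus_eq_zero_iff`. [folklore] -/
theorem sliceGenus_unknot [SphereEmbedding.SmoothnessFacts] (h0 : sliceGenus_eq_zero_iff) :
    unknot.sliceGenus = 0 :=
  (h0 unknot).2 isSmoothlySlice_unknot

end Knot

end Literature.Topology.FourManifolds
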